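import Summits.Ventures.PercRepro.PuncturedLYMTwoHyperplaneInter
import Summits.Ventures.PercRepro.PuncturedLYMTwoCoHypGenTheorem

/-!
# PercRepro — (NC) FOR EVERY PAVING MATROID WITH TWO NONTRIVIAL HYPERPLANES, NO COVER CONDITION (p10, gen 35)

* `toSub_sdiff`, `toSub_union` — the subtype dictionary on differences and unions;
* `puncturedNMP_in_union_upLevel'` — the general two-co-hyperplane theorem inside any finset `E`;
* `IsTwoHyperplaneF'` — a paving matroid of rank `r` whose dependent `r`-sets are the `r`-subsets of two proper subsets
  `H₁, H₂` of size `≥ r` with `#(H₁ ∩ H₂) ≤ r − 2` (automatic by PuncturedLYMTwoHyperplaneInter; no cover condition);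
* **`normConsAt_of_twoHyperplane_gen`** — **(NC) holds for every such matroid with `r + 1 ≤ n ≤ 2r − 2`**: the co-code is
  `upLevelIn (n − r) E (E ∖ H₁) ∪ upLevelIn (n − r) E (E ∖ H₂)`, the co-hyperplanes `E ∖ H_i` have `#(C₁ ∖ C₂) = #(H₂ ∖ H₁) ≥ 2`,
  `#(C₁ ∪ C₂) = n − #(H₁ ∩ H₂) ≥ n − r + 2`, and the equal-split flow gives (SP) inside `E`.
Nothing here asserts (SP), (PAV) or (NC) in general.
-/

open scoped Matroid

namespace PercRepro.PuncturedLYM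

open Finset

variable {α : Type} [DecidableEq α]

/-- `toSub` commutes with differences. -/
theorem toSub_sdiff (E X Y : Finset α) : toSub E (X \ Y) = toSub E X \ toSub E Y := by
  ext a
  simp only [mem_toSub, mem_sdiff]

/-- `toSub` commutes with unions. -/
theorem toSub_union (E X Y : Finset α) : toSub E (X ∪ Y) = toSub E X ∪ toSub E Y := by
  ext a
  simp only [mem_toSub, mem_union]

/-- **(SP) inside `E` for the `j`-subsets of `E` containing neither of two sets** `C₁, C₂ ⊆ E` with `#C_i ≤ j`,
`#(C₁ ∖ C₂), #(C₂ ∖ C₁) ≥ 2`, `#(C₁ ∪ C₂) ≥ j + 2` and `2j + 1 ≤ #E`. -/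
theorem puncturedNMP_in_union_upLevel' {j : ℕ} {E C₁ C₂ : Finset α} (hC₁ : C₁ ⊆ E) (hC₂ : C₂ ⊆ E)
    (hm₁j : C₁.card ≤ j) (hm₂j : C₂.card ≤ j) (hA : 2 ≤ (C₁ \ C₂).card) (hB : 2 ≤ (C₂ \ C₁).card)
    (hbig : j + 2 ≤ (C₁ ∪ C₂).card) (hn : 2 * j + 1 ≤ E.card) :
    PuncturedNMPIn j E (upLevelIn j E C₁ ∪ upLevelIn j E C₂) := by
  apply puncturedNMP_in_of_subtype'
  · intro B hB
    rcases mem_union.1 hB with h | h <;> exact subset_of_mem_upLevelIn h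
  · rw [image_union, image_toSub_upLevelIn hC₁, image_toSub_upLevelIn hC₂]
    apply puncturedNMP_union_upLevel'
    · rw [card_toSub hC₁]
      exact hm₁j
    · rw [card_toSub hC₂]
      exact hm₂j
    · rw [← toSub_sdiff, card_toSub (sdiff_subset.trans hC₁)]
      exact hA
    · rw [← toSub_sdiff, card_toSub (sdiff_subset.trans hC₂)]
      exact hB
    · rw [← toSub_union, card_toSub (union_subset hC₁ hC₂)]
      exact hbig
    · rw [Fintype.card_coe]
      exact hn

end PercRepro.PuncturedLYM

namespace PercRepro.Cogirth

open Finset ThmH Skew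

variable {α : Type} [DecidableEq α] {M : Matroid α} [M.Finite]

/-- **A paving matroid with two nontrivial hyperplanes** (no cover condition): rank `r`, paving, the dependent `r`-sets
are exactly the `r`-subsets of `H₁` or of `H₂`, proper subsets of the ground set of size `≥ r` meeting in at most
`r − 2` points. -/
def IsTwoHyperplaneF' (M : Matroid α) [M.Finite] (r : ℕ) (H₁ H₂ : Finset α) : Prop :=
  rk M (gr M) = r ∧ IsPaving M ∧ H₁ ⊆ gr M ∧ H₂ ⊆ gr M ∧
    H₁.card < (gr M).card ∧ H₂.card < (gr M).card ∧ r ≤ H₁.card ∧ r ≤ H₂.card ∧ (H₁ ∩ H₂).card + 2 ≤ r ∧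
    ∀ S ⊆ gr M, S.card = r → (rk M S ≠ S.card ↔ S ⊆ H₁ ∨ S ⊆ H₂)

/-- **(NC) FOR EVERY PAVING MATROID WITH TWO NONTRIVIAL HYPERPLANES**, with `r + 1 ≤ n ≤ 2r − 2`. -/
theorem normConsAt_of_twoHyperplane_gen {r : ℕ} {H₁ H₂ : Finset α} (h2 : IsTwoHyperplaneF' M r H₁ H₂)
    (hr1 : r + 1 ≤ (gr M).card) (hn : (gr M).card + 2 ≤ 2 * r) : NormConsAt M := by
  obtain ⟨hrk, hp, hH₁g, hH₂g, hH₁n, hH₂n, hrH₁, hrH₂, hinter, hH⟩ := h2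
  apply normConsAt_of_paving_of_puncturedNMPIn hp hrk hr1 hn
  rw [cocode_eq_union_upLevelIn (by omega) hH]
  have hsd₁ : (gr M \ H₁) \ (gr M \ H₂) = H₂ \ H₁ := by
    ext z
    simp only [mem_sdiff, not_and, not_not]
    constructor
    · rintro ⟨⟨hz, hz1⟩, h⟩
      exact ⟨h hz, hz1⟩
    · rintro ⟨hz2, hz1⟩
      exact ⟨⟨hH₂g hz2, hz1⟩, fun _ => hz2⟩
  have hsd₂ : (gr M \ H₂) \ (gr M \ H₁) = H₁ \ H₂ := by
    ext z
    simp only [mem_sdiff, not_and, not_not]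
    constructor
    · rintro ⟨⟨hz, hz2⟩, h⟩
      exact ⟨h hz, hz2⟩
    · rintro ⟨hz1, hz2⟩
      exact ⟨⟨hH₁g hz1, hz2⟩, fun _ => hz1⟩
  have hun : (gr M \ H₁) ∪ (gr M \ H₂) = gr M \ (H₁ ∩ H₂) := by
    ext z
    simp only [mem_union, mem_sdiff, mem_inter, not_and]
    tauto
  have hc1 : (H₂ \ H₁).card + (H₁ ∩ H₂).card = H₂.card := by
    have := card_sdiff_add_card_inter H₂ H₁
    rw [inter_comm] at this
    exact this
  have hc2 : (H₁ \ H₂).card + (H₁ ∩ H₂).card = H₁.card := card_sdiff_add_card_inter H₁ H₂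
  apply PuncturedLYM.puncturedNMP_in_union_upLevel' sdiff_subset sdiff_subset
  · rw [card_sdiff_of_subset hH₁g]
    omega
  · rw [card_sdiff_of_subset hH₂g]
    omega
  · rw [hsd₁]
    omega
  · rw [hsd₂]
    omega
  · rw [hun, card_sdiff_of_subset (inter_subset_left.trans hH₁g)]
    omega
  · omega

end PercRepro.Cogirth
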